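import Mathlib
import HarnessLib
import Summits.AtomisticToContinuum.Crystallization.Theorems.PricedLinkCensusSoftFourRingsReduction
import Summits.AtomisticToContinuum.Crystallization.Theorems.PricedLinkCensusSoftFourRingsThreeTriQuad

/-!
# Local exclusions in the soft link, twelve-point form

Route `PricedLinkCensus`, item `SoftFourRings` (stmt-AtomisticToContinuum-14234), blueprint step 3
(evidence `softrings-search.md` §3, §7), in the vocabulary of the normalised twelve-point reduction
`softFourRings_of_twelve_unit` (`PricedLinkCensusSoftFourRingsReduction`): twelve points `z j` with
`1 ≤ ‖z j‖ ≤ (1 + η) min 1 (n j)`, `n j ≤ ‖z j‖`, `n j ≤ dist (z j) (z k)` (`j ≠ k`), bonds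
`j ∼ k ⇔ dist (z j) (z k) ≤ (1 + η) min (n j) (n k)`, at tolerance `0 < η ≤ 1/100`.

* `link_unit_window`: the directions `u j = z j/‖z j‖` are pairwise at cosine
  `≤ 1 − 1/(2·1.01²)` and bonded pairs at cosine `≥ 1 − 1.01²/2` (the angular window
  `inner_le_of_link` / `le_inner_of_bond`, monotone in `η`).
* `no_four_cycle_link`: no site `v` has four distinct link-neighbours bonded cyclically — no link
  vertex of type `(3,3,3,3)` (`no_bonded_four_cycle_one_percent`).
* `no_three_path_link`: no site `v` has four distinct link-neighbours `w₀ ∼ w₁ ∼ w₂ ∼ w₃` bonded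
  along a path with `w₀`, `w₃` bonded to a common site `x ≠ v` — no link vertex of type
  `(3,3,3,4)` (`no_three_triangles_quad_one_percent`).

By a graph search over the fourteen 4-regular planar candidates (evidence file §2–§3) these two
exclusions leave exactly the cuboctahedral, the anticuboctahedral and the hexagonal-antiprism link.
-/

namespace Summit.AtomisticToContinuum.Crystallization.Theorems

open Real RealInnerProductSpace

/-- **The angular window, unit-vector form.**  Under the hypotheses of
`softFourRings_of_twelve_unit` with `0 < η ≤ 1/100`, the directions `u j = ‖z j‖⁻¹ • z j` are unit
vectors, any two distinct ones have `⟪u a, u b⟫ ≤ 1 − 1/(2·(101/100)²)`, and bonded ones have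
`1 − (101/100)²/2 ≤ ⟪u a, u b⟫`. -/
theorem link_unit_window {η : ℝ} (hη : 0 < η) (hη1 : η ≤ 1 / 100)
    {z : Fin 12 → EuclideanSpace ℝ (Fin 3)} {n : Fin 12 → ℝ}
    (h1 : ∀ j, 1 ≤ ‖z j‖) (h2 : ∀ j, ‖z j‖ ≤ (1 + η) * min 1 (n j)) (h3 : ∀ j, n j ≤ ‖z j‖)
    (h4 : ∀ j k, j ≠ k → n j ≤ dist (z j) (z k)) :
    ∃ u : Fin 12 → EuclideanSpace ℝ (Fin 3), (∀ j, ‖u j‖ = 1) ∧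
      (∀ a b, a ≠ b → ⟪u a, u b⟫ ≤ 1 - 1 / (2 * (101 / 100 : ℝ) ^ 2)) ∧
      (∀ a b, dist (z a) (z b) ≤ (1 + η) * min (n a) (n b) →
        1 - (101 / 100 : ℝ) ^ 2 / 2 ≤ ⟪u a, u b⟫) := by
  have hη0 : 0 ≤ η := hη.le
  have hη2 : η ≤ 1 / 2 := by linarith
  have hpos : ∀ j, 0 < ‖z j‖ := fun j => lt_of_lt_of_le one_pos (h1 j)
  -- the window constants are monotone in `η`
  have hca : 1 - 1 / (2 * (1 + η) ^ 2) ≤ 1 - 1 / (2 * (101 / 100 : ℝ) ^ 2) := by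
    have : (1 + η) ^ 2 ≤ (101 / 100 : ℝ) ^ 2 := by nlinarith
    have h2 : 1 / (2 * (101 / 100 : ℝ) ^ 2) ≤ 1 / (2 * (1 + η) ^ 2) :=
      one_div_le_one_div_of_le (by positivity) (by linarith)
    linarith
  have hcb : 1 - (101 / 100 : ℝ) ^ 2 / 2 ≤ 1 - (1 + η) ^ 2 / 2 := by nlinarith
  -- unit vectors
  set u : Fin 12 → EuclideanSpace ℝ (Fin 3) := fun j => (‖z j‖)⁻¹ • z j with hu
  have hun : ∀ j, ‖u j‖ = 1 := fun j => by
    rw [hu, norm_smul, norm_inv, norm_norm, inv_mul_cancel₀ (hpos j).ne']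
  have hinner : ∀ a b, ⟪u a, u b⟫ = ⟪z a, z b⟫ / (‖z a‖ * ‖z b‖) := by
    intro a b
    rw [hu, real_inner_smul_left, real_inner_smul_right, div_eq_inv_mul, mul_inv]
    ring
  have hmulpos : ∀ a b, 0 < ‖z a‖ * ‖z b‖ := fun a b => mul_pos (hpos a) (hpos b)
  refine ⟨u, hun, fun a b hab => ?_, fun a b hb => ?_⟩
  · rw [hinner, div_le_iff₀ (hmulpos a b)]
    exact (inner_le_of_link hη0 hη2 h1 h2 h4 hab).trans (mul_le_mul_of_nonneg_right hca
      (hmulpos a b).le)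
  · rw [hinner, le_div_iff₀ (hmulpos a b)]
    exact (mul_le_mul_of_nonneg_right hcb (hmulpos a b).le).trans (le_inner_of_bond hη0 h3 hb)

/-- **No link vertex with four triangular corners, twelve-point form.**  In the setting of
`softFourRings_of_twelve_unit` (`0 < η ≤ 1/100`), no site `v` has four distinct link-neighbours
`w 0, …, w 3` (bonded to `v`) that are bonded cyclically `w k ∼ w (k+1)`. -/
theorem no_four_cycle_link {η : ℝ} (hη : 0 < η) (hη1 : η ≤ 1 / 100)
    {z : Fin 12 → EuclideanSpace ℝ (Fin 3)} {n : Fin 12 → ℝ}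
    (h1 : ∀ j, 1 ≤ ‖z j‖) (h2 : ∀ j, ‖z j‖ ≤ (1 + η) * min 1 (n j)) (h3 : ∀ j, n j ≤ ‖z j‖)
    (h4 : ∀ j k, j ≠ k → n j ≤ dist (z j) (z k))
    (v : Fin 12) (w : Fin 4 → Fin 12) (hwinj : Function.Injective w) (hwv : ∀ k, w k ≠ v)
    (hbv : ∀ k, dist (z v) (z (w k)) ≤ (1 + η) * min (n v) (n (w k)))
    (hcyc : ∀ k : Fin 4, dist (z (w k)) (z (w (k + 1))) ≤ (1 + η) * min (n (w k)) (n (w (k + 1)))) :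
    False := by
  obtain ⟨u, hun, hsepU, hbondU⟩ := link_unit_window hη hη1 h1 h2 h3 h4
  exact no_bonded_four_cycle_one_percent (hun v) (fun k => u (w k)) (fun k => hun _)
    (fun k => ⟨hbondU _ _ (hbv k), hsepU _ _ (hwv k).symm⟩)
    (fun i j hij => hsepU _ _ (hwinj.ne hij)) (fun k => hbondU _ _ (hcyc k))

/-- **No link vertex with three triangular corners and a bridged fourth corner, twelve-point
form.**  In the setting of `softFourRings_of_twelve_unit` (`0 < η ≤ 1/100`), no site `v` has four
distinct link-neighbours `w 0 ∼ w 1 ∼ w 2 ∼ w 3` (bonded to `v` and along the path) such that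
`w 0` and `w 3` are both bonded to some site `x ≠ v`. -/
theorem no_three_path_link {η : ℝ} (hη : 0 < η) (hη1 : η ≤ 1 / 100)
    {z : Fin 12 → EuclideanSpace ℝ (Fin 3)} {n : Fin 12 → ℝ}
    (h1 : ∀ j, 1 ≤ ‖z j‖) (h2 : ∀ j, ‖z j‖ ≤ (1 + η) * min 1 (n j)) (h3 : ∀ j, n j ≤ ‖z j‖)
    (h4 : ∀ j k, j ≠ k → n j ≤ dist (z j) (z k))
    (v : Fin 12) (w : Fin 4 → Fin 12) (hwinj : Function.Injective w) (hwv : ∀ k, w k ≠ v)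
    (hbv : ∀ k, dist (z v) (z (w k)) ≤ (1 + η) * min (n v) (n (w k)))
    (hb01 : dist (z (w 0)) (z (w 1)) ≤ (1 + η) * min (n (w 0)) (n (w 1)))
    (hb12 : dist (z (w 1)) (z (w 2)) ≤ (1 + η) * min (n (w 1)) (n (w 2)))
    (hb23 : dist (z (w 2)) (z (w 3)) ≤ (1 + η) * min (n (w 2)) (n (w 3)))
    (x : Fin 12) (hxv : x ≠ v)
    (hx0 : dist (z (w 0)) (z x) ≤ (1 + η) * min (n (w 0)) (n x))
    (hx3 : dist (z (w 3)) (z x) ≤ (1 + η) * min (n (w 3)) (n x)) : False := by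
  obtain ⟨u, hun, hsepU, hbondU⟩ := link_unit_window hη hη1 h1 h2 h3 h4
  exact no_three_triangles_quad_one_percent (hun v) (fun k => u (w k)) (fun k => hun _) (u x)
    (hun x) (fun k => ⟨hbondU _ _ (hbv k), hsepU _ _ (hwv k).symm⟩)
    (fun i j hij => hsepU _ _ (hwinj.ne hij)) (hbondU _ _ hb01) (hbondU _ _ hb12)
    (hbondU _ _ hb23) (hsepU _ _ hxv.symm) (hbondU _ _ hx0) (hbondU _ _ hx3)

end Summit.AtomisticToContinuum.Crystallization.Theorems
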